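import Literature.Topology.FourManifolds.CircleFamilies
import Mathlib.Geometry.Manifold.BumpFunction
import Mathlib.Geometry.Manifold.Instances.Real
import Mathlib.Topology.MetricSpace.Thickening
import HarnessLib

/-!
# Chart boxes in `ℝ × M`, adapted bumps, margins, and finite box covers of `[a, b] × M`

Topic `Literature/Topology/FourManifolds`; infrastructure for the tree's proof of Whitney's
theorem *homotopic smooth embeddings `Mᵐ → Nⁿ` of a compact manifold are smoothly isotopic when
`n ≥ 2m + 2`* (H. Whitney, *Differentiable manifolds* (1936), §II Thm. 6; Milnor, *Lectures on
the h-cobordism theorem* (1965), Thm. 8.4 and Remark; facts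
`Literature.Topology.FourManifolds.Milnor1965_isSmoothlyIsotopic_of_homotopic(_of_two_mul_add_two_le)`,
`HomotopicEmbeddingsIsotopic.lean`).  Both halves of that proof — smoothing a continuous
homotopy `ℝ × M → N` relative to its ends, and perturbing a smooth homotopy into an isotopy —
proceed box by box: `[1/3, 2/3] × M` is covered by finitely many compact *chart boxes*
`[τ - δ, τ + δ] × B̄(u, r)` (`B̄(u, r)` a closed ball of the chart of `M` at `u`) whose concentric
boxes of thrice the size are mapped into chart sources of `N`, and the map is modified inside one
box at a time with the help of a smooth bump which is `1` on the box and supported in the box of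
twice the size (this is the scheme of the tree's circle case, `WhitneyCircleIsotopy.lean`, with
arcs of `S¹` replaced by chart balls of `M`).  Everything here is proved.

* `Literature.Topology.FourManifolds.chartBall`, `chartOpenBall`, `cbox`, `obox` — closed/open
  chart balls in `M` and closed/open boxes in `ℝ × M`, with their topology
  (`isCompact_chartBall`, `isOpen_obox`, …);
* `Literature.Topology.FourManifolds.exists_boxBump` — a smooth bump `ρ : ℝ × M → [0, 1]`, `= 1`
  on `cbox I τ δ u r`, with `tsupport ρ ⊆ cbox I τ (2δ) u (2r)`;
* `Literature.Topology.FourManifolds.exists_margin_add_mem` — small translates in a chart of `N`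
  of the image of a compact set stay inside a given open set;
* `Literature.Topology.FourManifolds.continuous_smul_of_tsupport_subset` — cutting off a map
  continuous on an open set by a bump supported in it gives a continuous map;
* `Literature.Topology.FourManifolds.exists_finite_boxCover` — for `M` compact and
  `H : ℝ × M → X` continuous, finitely many boxes centred in `[a, b] × M`, of time radius `≤ δ₀`,
  whose open cores cover `[a, b] × M` and whose thrice-size boxes are mapped by `H` into
  prescribed open neighbourhoods `𝒰 (H p)` of the images of their centres.

## References

* H. Whitney, *Differentiable manifolds*, Ann. of Math. (2) 37 (1936), 645–680, §§8–9.
  [Whitney1936]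
* J. Milnor, *Lectures on the h-cobordism theorem* (1965), Thm. 8.4 and Remark (PDF p. 56),
  Lemmas 6.11, 6.12 (PDF p. 42). [MilnorHCobordism1965]
* M. W. Hirsch, *Differential Topology*, GTM 33 (1976), Ch. 2 §2 (Thm. 2.6), Ch. 3 §2.
  [HirschDT1976]
-/

open scoped Manifold ContDiff Topology
open Function Set Filter Metric

noncomputable section

namespace Literature.Topology.FourManifolds

variable {EM : Type*} [NormedAddCommGroup EM] [NormedSpace ℝ EM] {HM : Type*} [TopologicalSpace HM]
  (I : ModelWithCorners ℝ EM HM) {M : Type*} [TopologicalSpace M] [ChartedSpace HM M]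

/-! ### Chart balls in `M` -/

section ChartBalls

/-- The **closed chart ball** of radius `r` about `u`: the points of the extended-chart source at
`u` whose chart coordinates lie in the closed ball of radius `r` about those of `u`. [folklore] -/
def chartBall (u : M) (r : ℝ) : Set M :=
  (extChartAt I u).source ∩ extChartAt I u ⁻¹' closedBall (extChartAt I u u) r

/-- The **open chart ball** of radius `r` about `u`. [folklore] -/
def chartOpenBall (u : M) (r : ℝ) : Set M :=
  (extChartAt I u).source ∩ extChartAt I u ⁻¹' ball (extChartAt I u u) r

variable {I}

/-- Membership in the closed chart ball. [folklore] -/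
theorem mem_chartBall {u : M} {r : ℝ} {y : M} :
    y ∈ chartBall I u r ↔
      y ∈ (extChartAt I u).source ∧ dist (extChartAt I u y) (extChartAt I u u) ≤ r := by
  simp [chartBall]

/-- Membership in the open chart ball. [folklore] -/
theorem mem_chartOpenBall {u : M} {r : ℝ} {y : M} :
    y ∈ chartOpenBall I u r ↔
      y ∈ (extChartAt I u).source ∧ dist (extChartAt I u y) (extChartAt I u u) < r := by
  simp [chartOpenBall]

variable (I)

/-- Chart balls lie in the chart source. [folklore] -/
theorem chartBall_subset_source (u : M) (r : ℝ) : chartBall I u r ⊆ (extChartAt I u).source :=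
  inter_subset_left

/-- Open chart balls lie in the chart source. [folklore] -/
theorem chartOpenBall_subset_source (u : M) (r : ℝ) :
    chartOpenBall I u r ⊆ (extChartAt I u).source :=
  inter_subset_left

/-- The open chart ball lies in the closed one. [folklore] -/
theorem chartOpenBall_subset_chartBall (u : M) (r : ℝ) : chartOpenBall I u r ⊆ chartBall I u r :=
  inter_subset_inter_right _ (preimage_mono ball_subset_closedBall)

/-- Closed chart balls increase with the radius. [folklore] -/
theorem chartBall_mono (u : M) {r r' : ℝ} (h : r ≤ r') : chartBall I u r ⊆ chartBall I u r' :=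
  inter_subset_inter_right _ (preimage_mono (closedBall_subset_closedBall h))

/-- A closed chart ball lies in every open chart ball of larger radius. [folklore] -/
theorem chartBall_subset_chartOpenBall (u : M) {r r' : ℝ} (h : r < r') :
    chartBall I u r ⊆ chartOpenBall I u r' :=
  inter_subset_inter_right _ (preimage_mono (closedBall_subset_ball h))

/-- The centre lies in its open chart balls. [folklore] -/
theorem self_mem_chartOpenBall (u : M) {r : ℝ} (hr : 0 < r) : u ∈ chartOpenBall I u r :=
  ⟨mem_extChartAt_source u, by simpa using hr⟩

/-- Open chart balls are open. [folklore] -/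
theorem isOpen_chartOpenBall (u : M) (r : ℝ) : IsOpen (chartOpenBall I u r) :=
  isOpen_extChartAt_preimage' u isOpen_ball

variable {I}

/-- A closed chart ball whose coordinate ball lies in the chart target is the image of that ball
under the inverse extended chart. [folklore] -/
theorem chartBall_eq_symm_image {u : M} {r : ℝ}
    (h : closedBall (extChartAt I u u) r ⊆ (extChartAt I u).target) :
    chartBall I u r = (extChartAt I u).symm '' closedBall (extChartAt I u u) r :=
  ((extChartAt I u).symm_image_eq_source_inter_preimage h).symm

/-- Such a closed chart ball is compact. [folklore] -/
theorem isCompact_chartBall [FiniteDimensional ℝ EM] {u : M} {r : ℝ}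
    (h : closedBall (extChartAt I u u) r ⊆ (extChartAt I u).target) :
    IsCompact (chartBall I u r) := by
  rw [chartBall_eq_symm_image h]
  exact (isCompact_closedBall _ _).image_of_continuousOn ((continuousOn_extChartAt_symm u).mono h)

/-- Such a closed chart ball is closed (`M` Hausdorff). [folklore] -/
theorem isClosed_chartBall [FiniteDimensional ℝ EM] [T2Space M] {u : M} {r : ℝ}
    (h : closedBall (extChartAt I u u) r ⊆ (extChartAt I u).target) :
    IsClosed (chartBall I u r) :=
  (isCompact_chartBall h).isClosed

end ChartBalls

/-! ### Boxes in `ℝ × M` -/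

section Boxes

/-- The **closed box** `[τ - δ, τ + δ] × chartBall I u r` in `ℝ × M`. [folklore] -/
def cbox (τ δ : ℝ) (u : M) (r : ℝ) : Set (ℝ × M) := Icc (τ - δ) (τ + δ) ×ˢ chartBall I u r

/-- The **open box** `(τ - δ, τ + δ) × chartOpenBall I u r` in `ℝ × M`. [folklore] -/
def obox (τ δ : ℝ) (u : M) (r : ℝ) : Set (ℝ × M) := Ioo (τ - δ) (τ + δ) ×ˢ chartOpenBall I u r

variable {I}

/-- Membership in the closed box. [folklore] -/
theorem mem_cbox {τ δ : ℝ} {u : M} {r : ℝ} {p : ℝ × M} :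
    p ∈ cbox I τ δ u r ↔ p.1 ∈ Icc (τ - δ) (τ + δ) ∧ p.2 ∈ chartBall I u r := Iff.rfl

/-- Membership in the open box. [folklore] -/
theorem mem_obox {τ δ : ℝ} {u : M} {r : ℝ} {p : ℝ × M} :
    p ∈ obox I τ δ u r ↔ p.1 ∈ Ioo (τ - δ) (τ + δ) ∧ p.2 ∈ chartOpenBall I u r := Iff.rfl

variable (I)

/-- Open boxes are open. [folklore] -/
theorem isOpen_obox (τ δ : ℝ) (u : M) (r : ℝ) : IsOpen (obox I τ δ u r) :=
  isOpen_Ioo.prod (isOpen_chartOpenBall I u r)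

/-- The open box lies in the closed box. [folklore] -/
theorem obox_subset_cbox (τ δ : ℝ) (u : M) (r : ℝ) : obox I τ δ u r ⊆ cbox I τ δ u r :=
  Set.prod_mono Ioo_subset_Icc_self (chartOpenBall_subset_chartBall I u r)

/-- Closed boxes increase with the radii. [folklore] -/
theorem cbox_mono (τ : ℝ) (u : M) {δ δ' r r' : ℝ} (hδ : δ ≤ δ') (hr : r ≤ r') :
    cbox I τ δ u r ⊆ cbox I τ δ' u r' :=
  Set.prod_mono (Icc_subset_Icc (by linarith) (by linarith)) (chartBall_mono I u hr)

/-- A closed box lies in every open box of larger radii. [folklore] -/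
theorem cbox_subset_obox (τ : ℝ) (u : M) {δ δ' r r' : ℝ} (hδ : δ < δ') (hr : r < r') :
    cbox I τ δ u r ⊆ obox I τ δ' u r' :=
  Set.prod_mono (Icc_subset_Ioo (by linarith) (by linarith))
    (chartBall_subset_chartOpenBall I u hr)

/-- Boxes lie over the chart source. [folklore] -/
theorem cbox_subset_prod_source (τ δ : ℝ) (u : M) (r : ℝ) :
    cbox I τ δ u r ⊆ (univ : Set ℝ) ×ˢ (extChartAt I u).source :=
  Set.prod_mono (subset_univ _) (chartBall_subset_source I u r)

/-- The centre lies in its open boxes. [folklore] -/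
theorem self_mem_obox (τ : ℝ) (u : M) {δ r : ℝ} (hδ : 0 < δ) (hr : 0 < r) :
    ((τ, u) : ℝ × M) ∈ obox I τ δ u r :=
  ⟨⟨by linarith, by linarith⟩, self_mem_chartOpenBall I u hr⟩

variable {I}

/-- Closed boxes whose coordinate ball lies in the chart target are compact. [folklore] -/
theorem isCompact_cbox [FiniteDimensional ℝ EM] {τ δ : ℝ} {u : M} {r : ℝ}
    (h : closedBall (extChartAt I u u) r ⊆ (extChartAt I u).target) :
    IsCompact (cbox I τ δ u r) :=
  isCompact_Icc.prod (isCompact_chartBall h)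

/-- Closed boxes whose coordinate ball lies in the chart target are closed (`M` Hausdorff).
[folklore] -/
theorem isClosed_cbox [FiniteDimensional ℝ EM] [T2Space M] {τ δ : ℝ} {u : M} {r : ℝ}
    (h : closedBall (extChartAt I u u) r ⊆ (extChartAt I u).target) :
    IsClosed (cbox I τ δ u r) :=
  (isCompact_cbox h).isClosed

end Boxes

/-! ### Bumps adapted to a box -/

section Bumps

/-- The topological support of `(t, y) ↦ a t * b y` lies in the product of the topological
supports. [folklore] -/
theorem tsupport_mul_prod_subset {Y : Type*} [TopologicalSpace Y] (a : ℝ → ℝ) (b : Y → ℝ) :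
    tsupport (fun p : ℝ × Y => a p.1 * b p.2) ⊆ tsupport a ×ˢ tsupport b := by
  have hs : support (fun p : ℝ × Y => a p.1 * b p.2) ⊆ support a ×ˢ support b := by
    intro p hp
    rw [mem_support, mul_ne_zero_iff] at hp
    exact ⟨hp.1, hp.2⟩
  refine (closure_mono hs).trans ?_
  rw [closure_prod_eq]
  exact Subset.rfl

/-- The topological support of the plateau bump `plateauBump (τ - δ) (τ + δ) δ` lies in
`[τ - 2δ, τ + 2δ]`. [folklore] -/
theorem tsupport_plateauBump_subset {τ δ : ℝ} (hδ : 0 < δ) :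
    tsupport (plateauBump (τ - δ) (τ + δ) δ) ⊆ Icc (τ - 2 * δ) (τ + 2 * δ) := by
  refine closure_minimal ?_ isClosed_Icc
  intro x hx
  rw [mem_support] at hx
  refine ⟨?_, ?_⟩
  · by_contra h
    exact hx (plateauBump_eq_zero_of_le hδ (by linarith [not_le.1 h]))
  · by_contra h
    exact hx (plateauBump_eq_zero_of_ge hδ (by linarith [not_le.1 h]))

variable [FiniteDimensional ℝ EM] [T2Space M] [IsManifold I ∞ M]

/-- **Bump adapted to a box.**  For `0 < δ`, `0 < r` and `closedBall (2r)` (in the chart at `u`)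
inside the chart target, there is a smooth `ρ : ℝ × M → [0, 1]` with `ρ = 1` on `cbox I τ δ u r`
and `tsupport ρ ⊆ cbox I τ (2δ) u (2r)`: the product of a plateau bump in time with a smooth
bump function of `M` centred at `u` (Mathlib's `SmoothBumpFunction`, radii `r < 2r`).
[folklore] -/
theorem exists_boxBump {τ δ : ℝ} {u : M} {r : ℝ} (hδ : 0 < δ) (hr : 0 < r)
    (h2r : closedBall (extChartAt I u u) (2 * r) ⊆ (extChartAt I u).target) :
    ∃ ρ : ℝ × M → ℝ, ContMDiff (𝓘(ℝ, ℝ).prod I) 𝓘(ℝ, ℝ) ∞ ρ ∧ (∀ p, 0 ≤ ρ p) ∧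
      (∀ p, ρ p ≤ 1) ∧ (∀ p ∈ cbox I τ δ u r, ρ p = 1) ∧
      tsupport ρ ⊆ cbox I τ (2 * δ) u (2 * r) := by
  set f : SmoothBumpFunction I u :=
    { rIn := r
      rOut := 2 * r
      rIn_pos := hr
      rIn_lt_rOut := by linarith
      closedBall_subset := fun y hy => h2r hy.1 } with hf
  refine ⟨fun p => plateauBump (τ - δ) (τ + δ) δ p.1 * f p.2, ?_, fun p => ?_, fun p => ?_,
    fun p hp => ?_, ?_⟩
  · exact ((contDiff_plateauBump _ _ _).contMDiff.comp contMDiff_fst).smul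
      (f.contMDiff.comp contMDiff_snd)
  · exact mul_nonneg (plateauBump_nonneg _ _ _ _) f.nonneg
  · exact mul_le_one₀ (plateauBump_le_one _ _ _ _) f.nonneg f.le_one
  · obtain ⟨⟨h1, h2⟩, hy⟩ := hp
    rw [mem_chartBall] at hy
    change plateauBump (τ - δ) (τ + δ) δ p.1 * f p.2 = 1
    rw [plateauBump_eq_one hδ h1 h2, one_mul]
    refine f.one_of_dist_le ?_ hy.2
    rw [← extChartAt_source (I := I)]
    exact hy.1
  · refine (tsupport_mul_prod_subset _ _).trans
      (Set.prod_mono (tsupport_plateauBump_subset hδ) ?_)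
    refine f.tsupport_subset_symm_image_closedBall.trans ?_
    rw [chartBall_eq_symm_image h2r]
    exact image_mono inter_subset_left

end Bumps

/-! ### Margins and cut-offs -/

section Margins

variable {n : ℕ} {N : Type*} [TopologicalSpace N] [ChartedSpace (EuclideanSpace ℝ (Fin n)) N]

/-- **Margin lemma.**  If `G : P → N` is continuous and maps the compact set `C` into the source
of the chart at `x`, and the chart images of `G '' C` lie in the open set `O ⊆ ℝⁿ`, then all
`y`-translates with `‖y‖ ≤ ε` of these images still lie in `O`, for some `ε > 0`
(`IsCompact.exists_cthickening_subset_open`; the circle case is `exists_pos_forall_add_mem`,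
`GenericCircleStep.lean`). [folklore] -/
theorem exists_margin_add_mem {P : Type*} [TopologicalSpace P] {G : P → N} (hG : Continuous G)
    {x : N} {C : Set P} (hC : IsCompact C)
    (hsrc : MapsTo G C (chartAt (EuclideanSpace ℝ (Fin n)) x).source)
    {O : Set (EuclideanSpace ℝ (Fin n))} (hO : IsOpen O)
    (hCO : ∀ p ∈ C, extChartAt (𝓡 n) x (G p) ∈ O) :
    ∃ ε : ℝ, 0 < ε ∧ ∀ p ∈ C, ∀ y : EuclideanSpace ℝ (Fin n), ‖y‖ ≤ ε →
      extChartAt (𝓡 n) x (G p) + y ∈ O := by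
  set S : Set (EuclideanSpace ℝ (Fin n)) := (fun p => extChartAt (𝓡 n) x (G p)) '' C with hS
  have hcont : ContinuousOn (fun p => extChartAt (𝓡 n) x (G p)) C := by
    refine (continuousOn_extChartAt x).comp hG.continuousOn ?_
    intro p hp
    rw [extChartAt_source]
    exact hsrc hp
  have hSc : IsCompact S := hC.image_of_continuousOn hcont
  have hSO : S ⊆ O := by
    rintro _ ⟨p, hp, rfl⟩
    exact hCO p hp
  obtain ⟨ε, hε, hεO⟩ := hSc.exists_cthickening_subset_open hO hSO
  refine ⟨ε, hε, fun p hp y hy => hεO ?_⟩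
  refine Metric.mem_cthickening_of_dist_le _ (extChartAt (𝓡 n) x (G p)) _ _ ⟨p, hp, rfl⟩ ?_
  simpa [dist_eq_norm] using hy

/-- **Cutting off by a bump supported where the map is continuous.**  If `χ` is continuous with
`tsupport χ ⊆ U`, `U` open, and `g` is continuous on `U`, then `p ↦ χ p • g p` is continuous
(it vanishes near every point outside `U`). [folklore] -/
theorem continuous_smul_of_tsupport_subset {P F : Type*} [TopologicalSpace P]
    [NormedAddCommGroup F] [NormedSpace ℝ F] {χ : P → ℝ} {g : P → F} {U : Set P}
    (hU : IsOpen U) (hχ : Continuous χ) (hsupp : tsupport χ ⊆ U) (hg : ContinuousOn g U) :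
    Continuous fun p => χ p • g p := by
  refine continuous_iff_continuousAt.2 fun p => ?_
  by_cases hp : p ∈ U
  · exact hχ.continuousAt.smul (hg.continuousAt (hU.mem_nhds hp))
  · have hp' : p ∉ tsupport χ := fun h => hp (hsupp h)
    have hev : (fun p => χ p • g p) =ᶠ[𝓝 p] fun _ => 0 := by
      filter_upwards [notMem_tsupport_iff_eventuallyEq.1 hp'] with q hq
      rw [hq, Pi.zero_apply, zero_smul]
    exact continuousAt_const.congr hev.symm

end Margins

/-! ### Finite box covers of `[a, b] × M` -/

section Cover

variable [I.Boundaryless]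

/-- **Local boxes.**  For `H : ℝ × M → X` continuous, an open set `O ∋ H p` and `δ₀ > 0`, there
are radii `0 < δ ≤ δ₀`, `0 < r` such that the closed coordinate ball of radius `3r` about `p.2`
lies in the chart target and the thrice-size box `cbox I p.1 (3δ) p.2 (3r)` is mapped by `H`
into `O`. [folklore] -/
theorem exists_box_radii {X : Type*} [TopologicalSpace X] {H : ℝ × M → X} (hH : Continuous H)
    (p : ℝ × M) {O : Set X} (hO : IsOpen O) (hpO : H p ∈ O) {δ₀ : ℝ} (hδ₀ : 0 < δ₀) :
    ∃ δ r : ℝ, 0 < δ ∧ δ ≤ δ₀ ∧ 0 < r ∧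
      closedBall (extChartAt I p.2 p.2) (3 * r) ⊆ (extChartAt I p.2).target ∧
      MapsTo H (cbox I p.1 (3 * δ) p.2 (3 * r)) O := by
  obtain ⟨T, W, hT, hW, hpT, hpW, hTW⟩ := isOpen_prod_iff.1 (hO.preimage hH) p.1 p.2 hpO
  -- time radius
  obtain ⟨ε, hε, hεT⟩ := Metric.isOpen_iff.1 hT p.1 hpT
  -- space radius
  have h1 : (extChartAt I p.2).target ∈ 𝓝 (extChartAt I p.2 p.2) := extChartAt_target_mem_nhds p.2
  have h2 : (extChartAt I p.2).symm ⁻¹' W ∈ 𝓝 (extChartAt I p.2 p.2) := by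
    refine (continuousAt_extChartAt_symm p.2).preimage_mem_nhds ?_
    rw [extChartAt_to_inv]
    exact hW.mem_nhds hpW
  obtain ⟨ε', hε', hε'sub⟩ := Metric.mem_nhds_iff.1 (inter_mem h1 h2)
  have hδpos : 0 < min (ε / 4) δ₀ := lt_min (by linarith) hδ₀
  have hδle : min (ε / 4) δ₀ ≤ ε / 4 := min_le_left _ _
  refine ⟨min (ε / 4) δ₀, ε' / 4, hδpos, min_le_right _ _, by linarith, ?_, ?_⟩
  · intro y hy
    exact (hε'sub (closedBall_subset_ball (by linarith) hy)).1
  · rintro ⟨t, y⟩ ⟨⟨ht1, ht2⟩, hy⟩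
    rw [mem_chartBall] at hy
    refine hTW ⟨hεT ?_, ?_⟩
    · rw [Metric.mem_ball, Real.dist_eq, abs_lt]
      exact ⟨by linarith, by linarith⟩
    · have hyt : extChartAt I p.2 y ∈ closedBall (extChartAt I p.2 p.2) (3 * (ε' / 4)) := hy.2
      have hmem := (hε'sub (closedBall_subset_ball (by linarith) hyt)).2
      rw [mem_preimage, (extChartAt I p.2).left_inv hy.1] at hmem
      exact hmem

variable [CompactSpace M]

/-- **Finite box cover.**  Let `M` be compact, `H : ℝ × M → X` continuous, `𝒰 x` an open
neighbourhood of each `x : X`, `a b : ℝ` and `δ₀ > 0`.  Then there are finitely many centres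
`p ∈ [a, b] × M` with radii `0 < δ p ≤ δ₀`, `0 < r p` such that: the closed coordinate balls of
radius `3 r p` lie in the chart targets, the thrice-size boxes `cbox I p.1 (3 δ p) p.2 (3 r p)`
are mapped by `H` into `𝒰 (H p)`, and the open boxes `obox I p.1 (δ p) p.2 (r p)` cover
`[a, b] × M` (compactness of `[a, b] × M`). [folklore] -/
theorem exists_finite_boxCover {X : Type*} [TopologicalSpace X] {H : ℝ × M → X}
    (hH : Continuous H) (𝒰 : X → Set X) (h𝒰o : ∀ x, IsOpen (𝒰 x)) (h𝒰 : ∀ x, x ∈ 𝒰 x)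
    (a b : ℝ) {δ₀ : ℝ} (hδ₀ : 0 < δ₀) :
    ∃ (s : Finset (ℝ × M)) (δ r : ℝ × M → ℝ),
      (∀ p ∈ s, p.1 ∈ Icc a b) ∧ (∀ p ∈ s, 0 < δ p ∧ δ p ≤ δ₀ ∧ 0 < r p) ∧
      (∀ p ∈ s, closedBall (extChartAt I p.2 p.2) (3 * r p) ⊆ (extChartAt I p.2).target) ∧
      (∀ p ∈ s, MapsTo H (cbox I p.1 (3 * δ p) p.2 (3 * r p)) (𝒰 (H p))) ∧
      ∀ q : ℝ × M, q.1 ∈ Icc a b → ∃ p ∈ s, q ∈ obox I p.1 (δ p) p.2 (r p) := by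
  choose δ r hδ hδle hr htgt hmaps using fun p : ℝ × M =>
    exists_box_radii (I := I) hH p (h𝒰o (H p)) (h𝒰 (H p)) hδ₀
  have hK : IsCompact (Icc a b ×ˢ (univ : Set M)) := isCompact_Icc.prod isCompact_univ
  obtain ⟨s, hsK, hcover⟩ := hK.elim_nhds_subcover (fun p => obox I p.1 (δ p) p.2 (r p))
    fun p _ => (isOpen_obox I _ _ _ _).mem_nhds (self_mem_obox I p.1 p.2 (hδ p) (hr p))
  refine ⟨s, δ, r, fun p hp => (hsK p hp).1, fun p _ => ⟨hδ p, hδle p, hr p⟩,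
    fun p _ => htgt p, fun p _ => hmaps p, fun q hq => ?_⟩
  have := hcover ⟨hq, mem_univ _⟩
  simpa only [mem_iUnion, exists_prop] using this

end Cover

end Literature.Topology.FourManifolds
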